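import Literature.MathematicalPhysics.QuantumFieldTheory.IsingGaugeQuarkPotential
import Literature.Probability.LatticeModels.CriticalTwoPointLower
import Mathlib.Analysis.SpecialFunctions.Artanh
import HarnessLib

/-!
# The sharp confinement ∕ deconfinement transition of Ising (`ℤ₂`) lattice gauge theory on `ℤ³`
# (Aizenman 2025, Thm 9.1) — named fact, with the dual critical coupling

M. Aizenman, *Geometric analysis of Ising models, Part III*, Math. Phys. Anal. Geom. **28** (2025)
no. 4 (doi:10.1007/s11040-025-09528-w) = arXiv:2509.02850 [Aizenman2025], §9.1, **Theorem 9.1**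
(arXiv numbering): «The lattice gauge model on `ℤ³` exhibits the following sharp transition from an
area-law to a perimeter-law:
`0 ≤ β < β_c ⟹ ⟨∏_{b ∈ ∂γ_ℓ} A_b⟩_{ℤ³,β} ≤ e^{-α(β) ℓ²}` at `α(β) > 0`;
`β > β_c ⟹ ⟨∏_{b ∈ ∂γ_ℓ} A_b⟩_{ℤ³,β} ≥ e^{-m(β) ℓ}` at `m(β) < ∞`.
The transition point `β_c` is related by duality to the Ising model's critical inverse temperature
through `coth(β_c^{(LGM)}) = exp{2 β_c^{(Ising)}}`, and the asymptotic value of `α(β)` (for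
`ℓ → ∞`) coincides with the dual Ising model's surface tension.» Here `γ_ℓ` is the boundary of the
`ℓ × ℓ` square `S_ℓ = (1,ℓ]² × {0}` in a coordinate plane, `A_b ∈ {±1}` are the bond variables, the
Hamiltonian is `H = -∑_p ∏_{b ∈ ∂p} A_b` (Balian–Drouffe–Itzykson), and `⟨·⟩_{ℤ³,β}` is the
`L → ∞` limit of the free-boundary models on `(-L,L]³ ∩ ℤ³` («Convergence … can be deduced through
monotonicity arguments based on the Griffith's second inequality», §9.1). The area-law half is
Lebowitz–Pfister 1981 (positivity of the Ising surface tension exactly for `β* > β_c^{Ising}`,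
Aizenman's Thm 8.2 [LebPfi81, BLP80]) transferred by the duality Thm 9.2; the perimeter-law half is
proved in §9.3 from the FK representation of the disorder operator (Thm 8.1), FKG, and the
exponential decay of the dual Ising two-point function (Aizenman–Barsky–Fernández 1987). The
finite-volume mechanism of §9.3 is PROVED in the tree
(`Literature/Probability/LatticeModels/IsingDisorderOperatorFK.lean`); Thm 9.1 itself is an
infinite-volume statement and is vendored here as ONE named fact, in the tree's vocabulary:

* the infinite-volume free-boundary `ℤ₂` Wilson loop `⟨W_{R×T}⟩_β` is
  `znWilsonLoopLimit 2 β x i j R T` (`IsingGaugeQuarkPotential.lean`; single-plaquette weight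
  `e^{β σ_p}`, the normalisation of the source: `⟨W_{1×1}⟩ = tanh β` in `d = 2`,
  `singlePlaquetteMean_z2`; the limit exists and is translation invariant,
  `hasBoxLimit_znWilsonLoopLimit`, `boxLimit_zdExpect_zn_wilsonLoop_eq_of_translate`, so the
  quantifier over the base point `x` below is the printed statement for `γ_ℓ ⊂ {x₃ = 0}`);
* the Ising critical inverse temperature of `ℤ³` is `criticalBeta 3`
  (`IsingThermodynamics.lean`: `inf {β ≥ 0 | m*(β) > 0}`, Friedli–Velenik Def. 3.29 — the
  magnetisation critical point of Lebowitz–Pfister's theorem; by Aizenman–Barsky–Fernández it is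
  also the threshold of exponential decay used in §9.3);
* the gauge critical coupling `z2GaugeCriticalBetaThree = artanh(e^{-2 β_c^{Ising}(ℤ³)})`, i.e.
  `tanh β_c = e^{-2 β_c^{Ising}}`, `coth β_c = e^{2 β_c^{Ising}}` (`tanh_z2GaugeCriticalBetaThree`,
  proved, as is `0 < β_c`).

Scope (read this first). Gauge group `ℤ₂`, dimension `3`, a NAMED FACT (not proved here; proved in
print). Consistent with the tree's proved a-priori bound `(tanh β)^{ℓ²} ≤ ⟨W_{ℓ×ℓ}⟩_β`
(`tanh_pow_le_znWilsonLoopLimit_two`), which forces `α(β) ≤ -log tanh β`. Nothing here bears on the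
four-dimensional Yang–Mills mass gap or on `BalabanLadder.IR`; in the `ym` ladder only the
conditional finite-`𝕋⁴` rung `BalabanLadder.UV` is closed by any route. Typed for the `ym-ir`
census, row A5 (whose random-surface antecedent, Aizenman–Chayes–Chayes–Fröhlich–Russo 1983, is the
BERNOULLI plaquette model on `ℤ³`, sharp at the bond-percolation threshold `1 - p_c(ℤ³)`:
Grimmett, *Percolation* (1999), Thm (12.22)).

## References

* M. Aizenman, Math. Phys. Anal. Geom. 28 (2025), arXiv:2509.02850, §9.1 Thm 9.1, §9.2 Thm 9.2,
  §9.3; §8.1 Thm 8.2 [Aizenman2025].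
* M. Aizenman, J. T. Chayes, L. Chayes, J. Fröhlich, L. Russo, Commun. Math. Phys. 92 (1983) 19–69,
  Thm 1.1 (p. 22), §7 i) (pp. 66–67) [AizenmanChayesChayesFrohlichRusso1983].
-/

noncomputable section

namespace Literature.MathematicalPhysics.QuantumFieldTheory

open Literature.Probability.LatticeModels

/-- **The critical coupling of `ℤ₂` lattice gauge theory on `ℤ³`**, defined through the duality
relation of Aizenman 2025, Thm 9.1 ∕ Thm 9.2 (1): `tanh β_c = e^{-2 β_c^{Ising}(ℤ³)}`, i.e.
`coth β_c^{(LGM)} = exp{2 β_c^{(Ising)}}`, with `β_c^{Ising}(ℤ³) = criticalBeta 3` the magnetisation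
critical point of the nearest-neighbour Ising model on the (self-dual) cubic lattice.
[cite: Aizenman2025, Thm 9.1 (the display defining β_c) and Thm 9.2 (1)] -/
def z2GaugeCriticalBetaThree : ℝ :=
  Real.artanh (Real.exp (-2 * criticalBeta 3))

/-- `0 < e^{-2 β_c^{Ising}(ℤ³)} < 1`, since `β_c^{Ising}(ℤ³) > 0` (Peierls; the tree's
`criticalBeta_pos_holds`). [cite: Aizenman2025, Thm 9.1 (β_c); FriedliVelenik2017 Thm. 3.25 (i)] -/
theorem exp_neg_two_mul_criticalBeta_three_mem_Ioo :
    Real.exp (-2 * criticalBeta 3) ∈ Set.Ioo (0 : ℝ) 1 := by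
  refine ⟨Real.exp_pos _, ?_⟩
  have h : 0 < criticalBeta 3 := criticalBeta_pos_holds (d := 3) (by norm_num)
  calc Real.exp (-2 * criticalBeta 3) < Real.exp 0 := Real.exp_lt_exp.2 (by linarith)
    _ = 1 := Real.exp_zero

/-- **The duality relation at criticality** (Aizenman 2025, Thm 9.1): `tanh β_c = e^{-2 β_c^{Ising}(ℤ³)}`
(equivalently `coth β_c = e^{2 β_c^{Ising}}`, `e^{2β*} = coth β` at `β* = β_c^{Ising}`).
[cite: Aizenman2025, Thm 9.1 (coth β_c^{LGM} = exp 2β_c^{Ising}) and Thm 9.2 (1)] -/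
theorem tanh_z2GaugeCriticalBetaThree :
    Real.tanh z2GaugeCriticalBetaThree = Real.exp (-2 * criticalBeta 3) := by
  have h := exp_neg_two_mul_criticalBeta_three_mem_Ioo
  exact Real.tanh_artanh ⟨by linarith [h.1], h.2⟩

/-- `β_c > 0`: the `ℤ₂` gauge theory on `ℤ³` has a non-trivial confining regime `[0, β_c)`
(Aizenman 2025, Thm 9.1: `0 ≤ β < β_c`). [cite: Aizenman2025, Thm 9.1] -/
theorem z2GaugeCriticalBetaThree_pos : 0 < z2GaugeCriticalBetaThree :=
  Real.artanh_pos exp_neg_two_mul_criticalBeta_three_mem_Ioo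

/-- **Aizenman 2025, Theorem 9.1 (sharp area-law ∕ perimeter-law transition of `ℤ₂` lattice gauge
theory on `ℤ³`)** — NAMED FACT (proved in print: area-law half = Lebowitz–Pfister 1981 via the
duality Thm 9.2; perimeter-law half = §9.3, FK representation of the disorder operator + FKG +
Aizenman–Barsky–Fernández 1987). For the infinite-volume free-boundary `ℤ₂` Wilson loop of the
`ℓ × ℓ` square `γ_ℓ` in the `(x₁,x₂)`-plane (any base point `x`, by translation invariance):
* `0 ≤ β < β_c ⟹ ∃ α(β) > 0, ∀ ℓ ≥ 1, ⟨W_{γ_ℓ}⟩_{ℤ³,β} ≤ e^{-α(β) ℓ²}` (area law),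
* `β > β_c ⟹ ∃ m(β) < ∞, ∀ ℓ ≥ 1, ⟨W_{γ_ℓ}⟩_{ℤ³,β} ≥ e^{-m(β) ℓ}` (perimeter law),
with `tanh β_c = e^{-2 β_c^{Ising}(ℤ³)}` (`z2GaugeCriticalBetaThree`). The identification of
`lim α(β)` with the dual Ising surface tension is not part of this statement.
[cite: Aizenman2025, §9.1 Thm 9.1] -/
def Aizenman2025_z2GaugeThree_sharpTransition : Prop :=
  (∀ β : ℝ, 0 ≤ β → β < z2GaugeCriticalBetaThree →
      ∃ α : ℝ, 0 < α ∧ ∀ (x : Probability.LatticeModels.Site 3) (ℓ : ℕ), 1 ≤ ℓ →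
        znWilsonLoopLimit 2 β x 0 1 ℓ ℓ ≤ Real.exp (-(α * (ℓ : ℝ) ^ 2))) ∧
  (∀ β : ℝ, z2GaugeCriticalBetaThree < β →
      ∃ m : ℝ, ∀ (x : Probability.LatticeModels.Site 3) (ℓ : ℕ), 1 ≤ ℓ →
        Real.exp (-(m * (ℓ : ℝ))) ≤ znWilsonLoopLimit 2 β x 0 1 ℓ ℓ)

/-- A consequence available in the tree without the fact, recorded for calibration of the constant:
by the proved a-priori bound `(tanh β)^{ℓ²} ≤ ⟨W_{ℓ×ℓ}⟩_β` (`tanh_pow_le_znWilsonLoopLimit_two`,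
Forsström–Viklund 2025 Prop. 6.2), any area-law constant of Thm 9.1 satisfies `α(β) ≤ -log tanh β`
for `β > 0`: if `⟨W_{γ_ℓ}⟩_β ≤ e^{-α ℓ²}` for some `ℓ ≥ 1` then `α ≤ -log tanh β`.
[cite: Aizenman2025, Thm 9.1; ForsstromViklund2025currents Prop. 6.2] -/
theorem areaLawConst_le_neg_log_tanh {β α : ℝ} (hβ : 0 < β) (x : Probability.LatticeModels.Site 3) {ℓ : ℕ} (hℓ : 1 ≤ ℓ)
    (h : znWilsonLoopLimit 2 β x 0 1 ℓ ℓ ≤ Real.exp (-(α * (ℓ : ℝ) ^ 2))) :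
    α ≤ -Real.log (Real.tanh β) := by
  have ht : 0 < Real.tanh β := by
    rw [Real.tanh_eq_sinh_div_cosh]
    exact div_pos (Real.sinh_pos_iff.2 hβ) (Real.cosh_pos β)
  have hlow := tanh_pow_le_znWilsonLoopLimit_two hβ.le x (show (0 : Fin 3) ≠ 1 by decide) ℓ ℓ
  have hle : Real.tanh β ^ (ℓ * ℓ) ≤ Real.exp (-(α * (ℓ : ℝ) ^ 2)) := hlow.trans h
  have hlog := Real.log_le_log (pow_pos ht _) hle
  rw [Real.log_exp, Real.log_pow] at hlog
  have hℓpos : (0 : ℝ) < (ℓ : ℝ) ^ 2 := by positivity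
  have : ((ℓ * ℓ : ℕ) : ℝ) = (ℓ : ℝ) ^ 2 := by push_cast; ring
  rw [this] at hlog
  -- `ℓ² log tanh β ≤ -α ℓ²`
  nlinarith

end Literature.MathematicalPhysics.QuantumFieldTheory
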